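/-
Copyright: the b2b-balaban T⁴-continuum CRUX team, row NE7b OWNER lineage `t4-ne7b-p1` (gen 119). Project licence.
-/
import Summits.QuantumFields.BalabanUV.T4Continuum.Spine.NE7b.SupTorusFormCeiling

/-!
# AN EXPLICIT CHART OF THE ZERO-MEAN FIELDS ON THE TORUS: on every block keep all local coordinates but the origin and put at the
# origin minus the sum of the others — a continuous linear `P : ℝ^{Site d s × {z ≠ 0}} → ℝ^{Site d ((n+1)s)}` with `Q′t∘P = 0`,
# `Σ ζ² ≤ Σ(P ζ)² ≤ ((n+1)^d + 1)·Σ ζ²`, ONTO `ker Q′t`; with it the integrated block-spin step on the torus of (122) has NO quantified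
# datum left: block lift, background map, chart, moduli `((min(2,a) − λ)(n+1)^d, (4d(n+1)² + a + λ)(n+1)^d)` and BOTH Laplace bounds,
# every period `s` (row NE7b, node U5c; (122) + (117) + TDF's block chart BY NAME; [folklore])

Cell `pub-balaban`, sub-cell `t4`, spine estimate NE7b (`T4WeightBudget.RelWeightBound`; the cell's OWN estimate — NOT PRINTED in
[Bałaban 1983–89], NOT PROVED).  Crux-route work under `Spine/NE7b/` by the row OWNER (`t4-ne7b-p1` gen 119) under FREEZE (0)'s
crux-prover clause (discharging the chart hypothesis of (121)∕(122)); NOTHING of Bałaban's is named as a Lean object, valued or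
asserted; no `T4Continuum/Support` leaf typed; no `def`, no notation (the chart is exhibited by `∃`); zero `sorry`.  Imports (BY NAME):
the OWNER's (122) `…SupTorusFormCeiling` (`torus_action_mem_twoSided_uniform`, `lift_sum_sq_eq`; through it (116) `integratedStep_closure`,
(117) `fibreMin_le_negLog_fibreIntegral` ∕ `negLog_fibreIntegral_le_fibreMin`, (110) `step_closure`, (96) `exists_clm_blockLift`, (93)
`sitewise_of_critical`, (89) `torus_blockAvg_apply` ∕ `blockVolume_mul_sum_sq_blockAvg_le`, TDF `siteOf_chart_bijective`).

WHY (located).  (121)∕(122) quantify the fluctuation chart `P`; on the torus the zero-mean fields of the block mean have the obvious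
coordinates «all sites of a block but one».  Through TDF's block chart `(y, z) ↦ siteOf(chart n (windowMap y) z)` (a bijection
`Site d s × (Fin d → Fin (n+1)) ≃ Site d ((n+1)s)`) this is the continuous linear map `(P ζ)(y, z) = ζ(y, z)` for `z ≠ 0` and
`(P ζ)(y, 0) = −Σ_{z ≠ 0} ζ(y, z)`: block sums vanish, `Σ(P ζ)² = Σ_y[(Σ_{z≠0} ζ)² + Σ_{z≠0} ζ²]` is squeezed between `Σ ζ²` and
`((n+1)^d + 1)Σ ζ²`, and a zero-mean field is recovered from its values off the block origins.

WHAT IS PROVED ([folklore]; the `Beta.Site` carriers, every `d, n, s`):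
* §1 `sum_split_zero` (`Σ_z g z = g 0 + Σ_{z ≠ 0} g z` on `Fin d → Fin (n+1)`), **`exists_fibreChart`** (`∃ P`, continuous linear on
  `Site d s × {z // z ≠ 0} → ℝ`: `Q′t(P ζ) = 0`; `Σ ζ² ≤ Σ(P ζ)²`; `Σ(P ζ)² ≤ ((n+1)^d + 1)·Σ ζ²`; every `h` with `Q′t h = 0` is some
  `P ζ`).
* §2 **`torus_integratedStep_explicit`** (THE END: `v′ = u`, `|u′| ≤ λ < min(2,a)` ⟹ `∃ P M Φ W′` with ALL of: `Q′t∘P = 0`, `Q′t∘M = 1`,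
  block means + sitewise equation for `Φ`, `HasFDerivAt W_int (W′ w) w`, lower letter `(min(2,a) − λ)(n+1)^d`, upper letter
  `(4d(n+1)² + a + λ)(n+1)^d`, and the two-sided Laplace sandwich
  `S(Φ w) − |σ|·log √(2π∕(min(2,a) − λ)) ≤ W_int(w) ≤ S(Φ w) − |σ|·log √(2π∕((4d(n+1)² + a + λ)((n+1)^d + 1)))`,
  `|σ| = |Site d s|·((n+1)^d − 1)` the number of integrated directions).
* §3 toy.

HONEST (what this is NOT).  Index bookkeeping on TDF's block chart plus assembly by name; one particular chart (any other differs by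
a `w`-independent Jacobian constant); no locality; `φ⁴` excluded (`|u′| ≤ λ`); cubic periods; scalar skeleton, hard constraint ((A3),
NC-NE7b-α UNRULED); nothing of Bałaban's.  BY-NAME EFFECT ON THE WALL: NONE.  NE7b NOT PRINTED ∕ NOT PROVED; spine PROVED 0∕9; rung
(B)+1 on a FINITE torus — NOT infinite volume, NOT the mass gap, NOT Clay.  HONEST DEPENDENCY: continuum YM on T⁴ ⇐ BetaPertH ∧ nine
spine estimates (0∕9 proved); BetaPertH ⇐ (D1) ∧ (D4) ∧ CAP+tail; G-an2-4 gates asym, D1 and NE2∕3∕4.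
-/

set_option autoImplicit false

noncomputable section

namespace Summit.QuantumFields.BalabanUV.T4Continuum.NE7b.SupTorusFibreChart

open Set Function MeasureTheory Real
open scoped ENNReal
open Literature.MathematicalPhysics.QuantumFieldTheory.Balaban1983to89
open B6QGQLower276 (X blk B side AX chart)
open B5Hk103ScalarZd (nbhd)
open Beta (Site siteOf windowMap)
open SupTorusDirichletForm (siteOf_chart_bijective)
open SupTorusDirichletFormCoercive (torus_blockAvg_apply blockVolume_mul_sum_sq_blockAvg_le)
open SupTorusActionMinimiser (sitewise_of_critical)
open SupTorusEffectiveActionGradient (exists_clm_blockLift)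
open SupConvexStepSemigroup (step_closure)
open SupConvexStepIntegrated (integratedStep_closure)
open SupConvexStepLaplace (fibreMin_le_negLog_fibreIntegral negLog_fibreIntegral_le_fibreMin)
open SupTorusFormCeiling (torus_action_mem_twoSided_uniform lift_sum_sq_eq)

variable {d : ℕ}

/-! ## §1. The chart -/

section Chart

variable (n s : ℕ) [NeZero s]

omit [NeZero s] in
/-- `Σ_z g z = g 0 + Σ_{z ≠ 0} g z` over the local coordinates `Fin d → Fin (n+1)`. [folklore] -/
theorem sum_split_zero (g : (Fin d → Fin (n + 1)) → ℝ) :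
    ∑ z, g z = g 0 + ∑ t : {z : Fin d → Fin (n + 1) // z ≠ 0}, g t.1 := by
  classical
  rw [← Fintype.sum_subtype_add_sum_subtype (fun z : Fin d → Fin (n + 1) => z ≠ 0) g, add_comm]
  congr 1
  haveI : Subsingleton {z : Fin d → Fin (n + 1) // ¬z ≠ 0} :=
    ⟨fun a b => Subtype.ext ((not_not.1 a.2).trans (not_not.1 b.2).symm)⟩
  exact Fintype.sum_subsingleton (fun i : {z : Fin d → Fin (n + 1) // ¬z ≠ 0} => g i.1)
    (⟨0, fun h => h rfl⟩ : {z : Fin d → Fin (n + 1) // ¬z ≠ 0})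

variable {Dop : lp (fun _ : X d => ℝ) ∞ →L[ℝ] lp (fun _ : X d => ℝ) ∞}
  (hD : ∀ (f : lp (fun _ : X d => ℝ) ∞) (y : X d), Dop f y = (((n : ℝ) + 1) ^ d)⁻¹ * ∑ p ∈ B n y, f p)
  {Ef : (Site d ((n + 1) * s) → ℝ) →L[ℝ] lp (fun _ : X d => ℝ) ∞}
  (hEf : ∀ (g : Site d ((n + 1) * s) → ℝ) (q : X d), Ef g q = g (siteOf d ((n + 1) * s) q))
  {Rc : lp (fun _ : X d => ℝ) ∞ →L[ℝ] (Site d s → ℝ)}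
  (hRc : ∀ (h : lp (fun _ : X d => ℝ) ∞) (x : Site d s), Rc h x = h (windowMap d s x))

include hD hEf hRc in
/-- **AN EXPLICIT CHART OF THE ZERO-MEAN FIELDS** («all sites of a block but the origin»): there is a continuous linear
`P : (Site d s × {z // z ≠ 0} → ℝ) → (Site d ((n+1)s) → ℝ)` with `Q′t(P ζ) = 0`, `Σ ζ² ≤ Σ(P ζ)² ≤ ((n+1)^d + 1)·Σ ζ²`, and every
zero-mean field is in its range. [folklore] -/
theorem exists_fibreChart :
    ∃ P : ((Site d s × {z : Fin d → Fin (n + 1) // z ≠ 0}) → ℝ) →L[ℝ] (Site d ((n + 1) * s) → ℝ),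
      (∀ ζ, ((Rc.comp Dop).comp Ef) (P ζ) = 0) ∧
      (∀ ζ, (1 : ℝ) * ∑ i, ζ i ^ 2 ≤ ∑ x, P ζ x ^ 2) ∧
      (∀ ζ, ∑ x, P ζ x ^ 2 ≤ (((n : ℝ) + 1) ^ d + 1) * ∑ i, ζ i ^ 2) ∧
      ∀ h : Site d ((n + 1) * s) → ℝ, ((Rc.comp Dop).comp Ef) h = 0 → ∃ ζ, P ζ = h := by
  classical
  -- TDF's block chart as an equivalence
  set E : Site d s × (Fin d → Fin (n + 1)) ≃ Site d ((n + 1) * s) :=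
    Equiv.ofBijective (fun yz : Site d s × (Fin d → Fin (n + 1)) => siteOf d ((n + 1) * s) (chart n (windowMap d s yz.1) yz.2))
      (siteOf_chart_bijective n s) with hE
  have hEapply : ∀ (y : Site d s) (z : Fin d → Fin (n + 1)), E (y, z) = siteOf d ((n + 1) * s) (chart n (windowMap d s y) z) :=
    fun y z => rfl
  -- the chart, fine site by fine site
  let L : Site d ((n + 1) * s) → ((Site d s × {z : Fin d → Fin (n + 1) // z ≠ 0}) → ℝ) →L[ℝ] ℝ := fun x =>
    if hx : (E.symm x).2 = 0 then
      -∑ t : {z : Fin d → Fin (n + 1) // z ≠ 0},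
        ContinuousLinearMap.proj (R := ℝ) (φ := fun _ : Site d s × {z : Fin d → Fin (n + 1) // z ≠ 0} => ℝ) ((E.symm x).1, t)
    else ContinuousLinearMap.proj (R := ℝ) (φ := fun _ : Site d s × {z : Fin d → Fin (n + 1) // z ≠ 0} => ℝ)
      ((E.symm x).1, ⟨(E.symm x).2, hx⟩)
  set P := ContinuousLinearMap.pi L with hP
  -- evaluation of the chart through the block chart
  have hPE : ∀ (ζ : (Site d s × {z : Fin d → Fin (n + 1) // z ≠ 0}) → ℝ) (y : Site d s) (z : Fin d → Fin (n + 1)),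
      P ζ (E (y, z)) = if hz : z = 0 then -∑ t : {z : Fin d → Fin (n + 1) // z ≠ 0}, ζ (y, t) else ζ (y, ⟨z, hz⟩) := by
    intro ζ y z
    rw [hP, ContinuousLinearMap.pi_apply]
    simp only [L, Equiv.symm_apply_apply]
    split_ifs with hz
    · simp only [neg_apply, sum_apply, ContinuousLinearMap.proj_apply]
    · simp only [ContinuousLinearMap.proj_apply]
  have hP0 : ∀ (ζ : (Site d s × {z : Fin d → Fin (n + 1) // z ≠ 0}) → ℝ) (y : Site d s),
      P ζ (E (y, 0)) = -∑ t : {z : Fin d → Fin (n + 1) // z ≠ 0}, ζ (y, t) := fun ζ y => by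
    rw [hPE, dif_pos rfl]
  have hPt : ∀ (ζ : (Site d s × {z : Fin d → Fin (n + 1) // z ≠ 0}) → ℝ) (y : Site d s)
      (t : {z : Fin d → Fin (n + 1) // z ≠ 0}), P ζ (E (y, t.1)) = ζ (y, t) := fun ζ y t => by
    rw [hPE, dif_neg t.2]
  -- block sums through the chart
  have hblocksum : ∀ (F : Site d ((n + 1) * s) → ℝ) (y : Site d s),
      ((Rc.comp Dop).comp Ef) F y = (((n : ℝ) + 1) ^ d)⁻¹ * ∑ z : Fin d → Fin (n + 1), F (E (y, z)) := fun F y => by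
    rw [ContinuousLinearMap.comp_apply, ContinuousLinearMap.comp_apply, torus_blockAvg_apply n s hD hEf hRc F y]
    rfl
  -- the sum of squares through the chart
  have hsumsq : ∀ ζ : (Site d s × {z : Fin d → Fin (n + 1) // z ≠ 0}) → ℝ,
      ∑ x, P ζ x ^ 2 = ∑ y : Site d s, ((∑ t : {z : Fin d → Fin (n + 1) // z ≠ 0}, ζ (y, t)) ^ 2
        + ∑ t : {z : Fin d → Fin (n + 1) // z ≠ 0}, ζ (y, t) ^ 2) := fun ζ => by
    rw [← E.sum_comp (fun x => P ζ x ^ 2), Fintype.sum_prod_type]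
    refine Finset.sum_congr rfl fun y _ => ?_
    rw [sum_split_zero n (fun z => P ζ (E (y, z)) ^ 2)]
    simp only [hP0, hPt, neg_sq]
  have hζsq : ∀ ζ : (Site d s × {z : Fin d → Fin (n + 1) // z ≠ 0}) → ℝ,
      ∑ i, ζ i ^ 2 = ∑ y : Site d s, ∑ t : {z : Fin d → Fin (n + 1) // z ≠ 0}, ζ (y, t) ^ 2 := fun ζ =>
    Fintype.sum_prod_type _
  refine ⟨P, fun ζ => ?_, fun ζ => ?_, fun ζ => ?_, fun h hh => ?_⟩
  · -- zero block means
    funext y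
    rw [hblocksum, Pi.zero_apply, sum_split_zero n (fun z => P ζ (E (y, z)))]
    simp only [hP0, hPt, neg_add_cancel, mul_zero]
  · -- injectivity, constant `1`
    rw [one_mul, hsumsq, hζsq]
    exact Finset.sum_le_sum fun y _ => le_add_of_nonneg_left (sq_nonneg _)
  · -- the ceiling `(n+1)^d + 1`
    rw [hsumsq, hζsq, Finset.mul_sum]
    refine Finset.sum_le_sum fun y _ => ?_
    have hCS := sq_sum_le_card_mul_sum_sq (s := (Finset.univ : Finset {z : Fin d → Fin (n + 1) // z ≠ 0}))
      (f := fun t => ζ (y, t))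
    have hcard : ((Finset.univ : Finset {z : Fin d → Fin (n + 1) // z ≠ 0}).card : ℝ) ≤ ((n : ℝ) + 1) ^ d := by
      rw [Finset.card_univ]
      have h1 := Fintype.card_subtype_le (fun z : Fin d → Fin (n + 1) => z ≠ 0)
      have h2 : (Fintype.card (Fin d → Fin (n + 1)) : ℝ) = ((n : ℝ) + 1) ^ d := by simp
      rw [← h2]
      exact_mod_cast h1
    have hS : 0 ≤ ∑ t : {z : Fin d → Fin (n + 1) // z ≠ 0}, ζ (y, t) ^ 2 := Finset.sum_nonneg fun t _ => sq_nonneg _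
    nlinarith [mul_le_mul_of_nonneg_right hcard hS]
  · -- onto the zero-mean fields
    refine ⟨fun i => h (E (i.1, i.2.1)), funext fun x => ?_⟩
    obtain ⟨⟨y, z⟩, rfl⟩ := E.surjective x
    rw [hPE]
    split_ifs with hz
    · subst hz
      have hsum : ∑ z : Fin d → Fin (n + 1), h (E (y, z)) = 0 := by
        have hy := congr_fun hh y
        rw [hblocksum, Pi.zero_apply] at hy
        have hvol : (((n : ℝ) + 1) ^ d)⁻¹ ≠ 0 := by positivity
        exact (mul_eq_zero.1 hy).resolve_left hvol
      rw [sum_split_zero n (fun z => h (E (y, z)))] at hsum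
      linarith
    · rfl

end Chart

/-! ## §2. The integrated step on the torus with the explicit chart -/

section Torus

variable (n : ℕ) (a : ℝ) (s : ℕ) [NeZero s]
  {Dop Aop : lp (fun _ : X d => ℝ) ∞ →L[ℝ] lp (fun _ : X d => ℝ) ∞}
  (hD : ∀ (f : lp (fun _ : X d => ℝ) ∞) (y : X d), Dop f y = (((n : ℝ) + 1) ^ d)⁻¹ * ∑ p ∈ B n y, f p)
  (hA : ∀ (f : lp (fun _ : X d => ℝ) ∞) (p : X d), Aop f p = ∑ r ∈ nbhd n p, AX n a p r * f r)
  {v u u' : ℝ → ℝ} (hv : ∀ t, HasDerivAt v (u t) t) (hu : ∀ t, HasDerivAt u (u' t) t)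
  {lam : ℝ} (hlam : ∀ t, |u' t| ≤ lam) (hγ : lam < min 2 a)
  {Ef : (Site d ((n + 1) * s) → ℝ) →L[ℝ] lp (fun _ : X d => ℝ) ∞}
  (hEf : ∀ (g : Site d ((n + 1) * s) → ℝ) (q : X d), Ef g q = g (siteOf d ((n + 1) * s) q))
  {Rf : lp (fun _ : X d => ℝ) ∞ →L[ℝ] (Site d ((n + 1) * s) → ℝ)}
  (hRf : ∀ (h : lp (fun _ : X d => ℝ) ∞) (x : Site d ((n + 1) * s)), Rf h x = h (windowMap d ((n + 1) * s) x))
  {Rc : lp (fun _ : X d => ℝ) ∞ →L[ℝ] (Site d s → ℝ)}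
  (hRc : ∀ (h : lp (fun _ : X d => ℝ) ∞) (x : Site d s), Rc h x = h (windowMap d s x))

include hD hA hv hu hlam hγ hEf hRf hRc in
/-- **THE END: THE INTEGRATED BLOCK-SPIN STEP ON THE TORUS, NOTHING QUANTIFIED.**  `v′ = u`, `|u′| ≤ λ`, `λ < min(2,a)`.  With the
fluctuation coordinates `σ = Site d s × {z // z ≠ 0}` there are: a chart `P` of the zero-mean fields (`Q′t∘P = 0`), the block lift `M`
(`Q′t∘M = 1`), the torus background map `Φ` (block means + sitewise equation) and a derivative family `W′` of
`W_int(w) = −log ∫ e^{−S(M w + P z)} dz` such that at every coarse field: `HasFDerivAt W_int (W′ w) w`; the first-order letter with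
modulus `(min(2,a) − λ)(n+1)^d`; the upper letter with modulus `(4d(n+1)² + a + λ)(n+1)^d`; and the two-sided Laplace sandwich
`S(Φ w) − |σ|·log √(2π∕(min(2,a) − λ)) ≤ W_int(w) ≤ S(Φ w) − |σ|·log √(2π∕((4d(n+1)² + a + λ)((n+1)^d + 1)))` — every period `s`.
[folklore] -/
theorem torus_integratedStep_explicit :
    ∃ (P : ((Site d s × {z : Fin d → Fin (n + 1) // z ≠ 0}) → ℝ) →L[ℝ] (Site d ((n + 1) * s) → ℝ))
      (M : (Site d s → ℝ) →L[ℝ] (Site d ((n + 1) * s) → ℝ)) (Φ : (Site d s → ℝ) → (Site d ((n + 1) * s) → ℝ))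
      (W' : (Site d s → ℝ) → (Site d s → ℝ) →L[ℝ] ℝ),
      (∀ ζ, ((Rc.comp Dop).comp Ef) (P ζ) = 0) ∧
      (∀ k, ((Rc.comp Dop).comp Ef) (M k) = k) ∧
      (∀ w, ((Rc.comp Dop).comp Ef) (Φ w) = w) ∧
      (∀ (w : Site d s → ℝ) (q : X d), Aop (Ef (Φ w)) q + u (Ef (Φ w) q)
        = (((n : ℝ) + 1) ^ d)⁻¹ * ∑ q' ∈ B n (blk n q), (Aop (Ef (Φ w)) q' + u (Ef (Φ w) q'))) ∧
      (∀ w, HasFDerivAt (fun w : Site d s → ℝ => -log (∫ z : (Site d s × {z : Fin d → Fin (n + 1) // z ≠ 0}) → ℝ,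
          exp (-((1 / 2 : ℝ) * ∑ x, (M w + P z) x * ((Rf.comp Aop).comp Ef) (M w + P z) x + ∑ x, v ((M w + P z) x)))))
        (W' w) w) ∧
      (∀ w w' : Site d s → ℝ,
        -log (∫ z : (Site d s × {z : Fin d → Fin (n + 1) // z ≠ 0}) → ℝ,
            exp (-((1 / 2 : ℝ) * ∑ x, (M w + P z) x * ((Rf.comp Aop).comp Ef) (M w + P z) x + ∑ x, v ((M w + P z) x))))
          + W' w (w' - w) + (min 2 a - lam) * ((n : ℝ) + 1) ^ d / 2 * ∑ y, (w' y - w y) ^ 2 ≤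
        -log (∫ z : (Site d s × {z : Fin d → Fin (n + 1) // z ≠ 0}) → ℝ,
            exp (-((1 / 2 : ℝ) * ∑ x, (M w' + P z) x * ((Rf.comp Aop).comp Ef) (M w' + P z) x
              + ∑ x, v ((M w' + P z) x))))) ∧
      (∀ w w' : Site d s → ℝ,
        -log (∫ z : (Site d s × {z : Fin d → Fin (n + 1) // z ≠ 0}) → ℝ,
            exp (-((1 / 2 : ℝ) * ∑ x, (M w' + P z) x * ((Rf.comp Aop).comp Ef) (M w' + P z) x + ∑ x, v ((M w' + P z) x))))
          ≤ -log (∫ z : (Site d s × {z : Fin d → Fin (n + 1) // z ≠ 0}) → ℝ,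
            exp (-((1 / 2 : ℝ) * ∑ x, (M w + P z) x * ((Rf.comp Aop).comp Ef) (M w + P z) x + ∑ x, v ((M w + P z) x))))
          + W' w (w' - w)
          + (4 * d * ((n : ℝ) + 1) ^ 2 + a + lam) * ((n : ℝ) + 1) ^ d / 2 * ∑ y, (w' y - w y) ^ 2) ∧
      (∀ w : Site d s → ℝ,
        ((1 / 2 : ℝ) * ∑ x, Φ w x * ((Rf.comp Aop).comp Ef) (Φ w) x + ∑ x, v (Φ w x))
          - Fintype.card (Site d s × {z : Fin d → Fin (n + 1) // z ≠ 0}) * log (√(2 * π / ((min 2 a - lam) * 1))) ≤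
        -log (∫ z : (Site d s × {z : Fin d → Fin (n + 1) // z ≠ 0}) → ℝ,
            exp (-((1 / 2 : ℝ) * ∑ x, (M w + P z) x * ((Rf.comp Aop).comp Ef) (M w + P z) x + ∑ x, v ((M w + P z) x))))) ∧
      ∀ w : Site d s → ℝ,
        -log (∫ z : (Site d s × {z : Fin d → Fin (n + 1) // z ≠ 0}) → ℝ,
            exp (-((1 / 2 : ℝ) * ∑ x, (M w + P z) x * ((Rf.comp Aop).comp Ef) (M w + P z) x + ∑ x, v ((M w + P z) x)))) ≤
        ((1 / 2 : ℝ) * ∑ x, Φ w x * ((Rf.comp Aop).comp Ef) (Φ w) x + ∑ x, v (Φ w x))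
          - Fintype.card (Site d s × {z : Fin d → Fin (n + 1) // z ≠ 0})
            * log (√(2 * π / ((4 * d * ((n : ℝ) + 1) ^ 2 + a + lam) * (((n : ℝ) + 1) ^ d + 1)))) := by
  have hm : 0 < min 2 a - lam := sub_pos.2 hγ
  have hlam0 : 0 ≤ lam := (abs_nonneg _).trans (hlam 0)
  have ha : 0 < a := lt_of_le_of_lt hlam0 (hγ.trans_le (min_le_right _ _))
  obtain ⟨P, hQP, hP, hP', hPsurj⟩ := exists_fibreChart n s hD hEf hRc
  obtain ⟨M, hMapply, hM⟩ := exists_clm_blockLift n s hD hEf hRc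
  obtain ⟨hS, hlo, hup⟩ := torus_action_mem_twoSided_uniform n a s hA hv hu hlam hEf hRf ha.le
  have hΛ : 0 < 4 * d * ((n : ℝ) + 1) ^ 2 + a + lam := by positivity
  have hJ : ∀ h : Site d ((n + 1) * s) → ℝ,
      ((n : ℝ) + 1) ^ d * ∑ y, ((Rc.comp Dop).comp Ef) h y ^ 2 ≤ ∑ x, h x ^ 2 := fun h => by
    simpa only [ContinuousLinearMap.comp_apply] using blockVolume_mul_sum_sq_blockAvg_le n s hD hEf hRc h
  have hμ : ∀ k : Site d s → ℝ, ∑ x, M k x ^ 2 ≤ ((n : ℝ) + 1) ^ d * ∑ y, k y ^ 2 :=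
    fun k => (lift_sum_sq_eq n s M hMapply k).le
  obtain ⟨Φ, hΦQ, hΦcrit, hΦmin, -, -, -⟩ := step_closure hS hlo hm ((Rc.comp Dop).comp Ef) M hM hJ
  obtain ⟨W', hW', hWlo, hWup⟩ :=
    integratedStep_closure ((Rc.comp Dop).comp Ef) M P hS hlo hm hup hΛ.le hM hμ hJ hQP hP one_pos
  refine ⟨P, M, Φ, W', hQP, hM, hΦQ, fun w q => sitewise_of_critical n a s hD hA hEf hRf hRc hv (Φ w) (hΦcrit w) q, hW',
    fun w w' => ?_, fun w w' => ?_, fun w => ?_, fun w => ?_⟩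
  · have h := hWlo w w'
    simpa only [mul_div_assoc, mul_assoc] using h
  · have h := hWup w w'
    simpa only [mul_div_assoc, mul_assoc] using h
  · exact fibreMin_le_negLog_fibreIntegral ((Rc.comp Dop).comp Ef) M P hS hlo hm hM hQP hP one_pos hΦmin w
  · exact negLog_fibreIntegral_le_fibreMin ((Rc.comp Dop).comp Ef) M P hS hlo hm hup hΛ hM hQP hP one_pos hPsurj hP'
      (by positivity) hΦQ hΦcrit w

end Torus

/-! ## §3. Toy -/

/-- Toy (§1 `sum_split_zero` with `d = 0`, `n = 0`: the only local coordinate is `0`, the split reads `g 0 = g 0 + 0`). -/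
example (g : (Fin 0 → Fin (0 + 1)) → ℝ) : ∑ z, g z = g 0 + ∑ t : {z : Fin 0 → Fin (0 + 1) // z ≠ 0}, g t.1 :=
  sum_split_zero 0 g

end Summit.QuantumFields.BalabanUV.T4Continuum.NE7b.SupTorusFibreChart

end
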